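/-
Copyright (c) 2026 the pub-hodgecm-mathlib formalisation cell (harness21).  Prover seat hodgecm-mathlib-F0P3a-p08 (g18): road «S3-tree» ROUTE (A) «SHALIKA» (LEAD F0P3a-plan
(g12), architect A-p16 (g30) ruling A-98 (1)), organ ‹RANK› — level bookkeeping; 2026-09-01.
-/
import Literature.NumberTheory.Automorphic.UnitaryThreeLevelTwoCongruence             -- ★ p846341 (RIGID-2 (A1), F0P3-p03): `IsIntMatrix` bookkeeping (`v_mul_le_of_le_of_le_one`, `v_mul_le_of_le_one_of_le`, `isIntMatrix_mul∕sub∕one`); brings `IsIntMatrix`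
import HarnessLib

/-!
# Levels of `g − 1` and `(g − 1)²` for `g ∈ GL_N(K)` over a valued field: invariance under `GL_N(𝒪)`-conjugation and under left multiplication by deep elements

Topic `NumberTheory/Automorphic`; namespace `Literature.NumberTheory.Automorphic.UnitaryLatticeTree` (home of ★ `IsIntMatrix`).  THEOREMS ONLY (no definition, no
instance, no notation, no named fact, no `sorry`); kernel lane; any `N`, any field `K` with `Valued K ℤᵐ⁰`.  Cell `pub/hodgecm-mathlib` (D-0151), crux H413 =
`stmt-HodgeConjecture-24833`; road «S3-tree» ROUTE (A) «SHALIKA», organ ‹RANK› (architect A-98 (1); END contract v5 `stub_rankCM`): the LEVEL SETS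
`K(j) = {g : g − 1 ≡ 0 (mod 𝔪^j)}` and the residually-regular set `{g : (g − 1)² ≢ 0 (mod 𝔪)}` are the RANK pieces; this file is the valuation bookkeeping showing they
are `Ad GL_N(𝒪)`-stable and stable under left multiplication by `K(j)` — written once, for the «all entries of `X` have valuation `≤ c`» predicate (`c : ℤᵐ⁰`), so that
the CM instantiation is transport only.  (Companion idiom: ★ `isIntMatrix_inv_smul_iff` turns `IsIntMatrix (c⁻¹ • X)` into this predicate with `c ↦ |c|`.)
THE MATHEMATICS (ultrametric inequality only).  `A X A′` with `A, A′` integral has entries `≤ max |X|`; `k g k⁻¹ − 1 = k (g − 1) k⁻¹` and `(k g k⁻¹ − 1)² = k (g − 1)² k⁻¹`;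
`u g − 1 = (u − 1) g + (g − 1)` and `(u g − 1)² − (g − 1)² = (g − 1)E + E(g − 1) + E²`, `E = (u − 1) g`.
HONEST LABEL: HC_CM is proved only modulo the 2 remaining named inputs (hLiu418 24832, h413 24833) until rung 0 closes; nothing printed is asserted here.

* `forall_v_mul_mul_apply_le`, `forall_v_apply_le_iff_of_sub`, `coe_conj_sub_one_sq_eq` (over ★ `coe_conj_sub_one`), **`forall_v_conj_sub_one_apply_le_iff`**,
  **`forall_v_conj_sub_one_sq_apply_le_iff`**, `isIntMatrix_conj_iff`, **`forall_v_mul_sub_one_apply_le_iff`**, **`forall_v_mul_sub_one_sq_apply_le_iff`**.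

## References
* [Tits1979] J. Tits, *Reductive groups over local fields*, PSPM 33.1 (1979), §3.5 (congruence filtration of a hyperspecial parahoric).
* [Rogawski1990] J. D. Rogawski, *Automorphic Representations of Unitary Groups in Three Variables*, Ann. of Math. Stud. 123 (1990), §4.9 p. 54, §8.1 p. 112.
-/

set_option autoImplicit false

open scoped Matrix MatrixGroups Valued WithZero
open Matrix

namespace Literature.NumberTheory.Automorphic.UnitaryLatticeTree

open Literature.NumberTheory.Automorphic.UnitaryGroup

variable {K : Type*} [Field K] [Valued K ℤᵐ⁰] {N : ℕ}

/-- `X ↦ A·X·A′` with `A, A′` integral does not increase the maximal entry valuation. [cite: Tits1979, §3.5] -/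
theorem forall_v_mul_mul_apply_le {A A' X : Matrix (Fin N) (Fin N) K} (hA : IsIntMatrix A) (hA' : IsIntMatrix A') {c : ℤᵐ⁰}
    (hX : ∀ a b, Valued.v (X a b) ≤ c) (a b : Fin N) : Valued.v ((A * X * A') a b) ≤ c := by
  rw [Matrix.mul_apply]
  refine Valuation.map_sum_le _ fun k _ => ?_
  refine v_mul_le_of_le_of_le_one ?_ (hA' k b)
  rw [Matrix.mul_apply]
  exact Valuation.map_sum_le _ fun l _ => v_mul_le_of_le_one_of_le (hA a l) (hX l k)

/-- Ultrametric transfer: if `X − Y` has all entries of valuation `≤ c`, then «all entries of `X` are `≤ c`» iff «all entries of `Y` are `≤ c`». [cite: Tits1979, §3.5] -/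
theorem forall_v_apply_le_iff_of_sub {m : Type*} {X Y : Matrix m m K} {c : ℤᵐ⁰} (h : ∀ a b, Valued.v ((X - Y) a b) ≤ c) :
    (∀ a b, Valued.v (X a b) ≤ c) ↔ (∀ a b, Valued.v (Y a b) ≤ c) := by
  constructor
  · intro hX a b
    have := Valued.v.map_sub_le (hX a b) (h a b)
    rwa [Matrix.sub_apply, sub_sub_cancel] at this
  · intro hY a b
    have := Valued.v.map_add_le (h a b) (hY a b)
    rwa [Matrix.sub_apply, sub_add_cancel] at this

omit [Valued K ℤᵐ⁰] in
/-- Conjugation: `(k g k⁻¹ − 1)² = k (g − 1)² k⁻¹` (★ `coe_conj_sub_one`, `Units.conj_pow`). [cite: Rogawski1990, §1.10 p. 9] -/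
theorem coe_conj_sub_one_sq_eq {N : ℕ} (k g : GL (Fin N) K) :
    (((k * g * k⁻¹ : GL (Fin N) K) : Matrix (Fin N) (Fin N) K) - 1) * (((k * g * k⁻¹ : GL (Fin N) K) : Matrix (Fin N) (Fin N) K) - 1) =
      (k : Matrix (Fin N) (Fin N) K) * (((g : Matrix (Fin N) (Fin N) K) - 1) * ((g : Matrix (Fin N) (Fin N) K) - 1)) *
        ((k⁻¹ : GL (Fin N) K) : Matrix (Fin N) (Fin N) K) := by
  rw [coe_conj_sub_one, ← pow_two, Units.conj_pow, pow_two]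

/-- **`GL_N(𝒪)`-conjugation preserves the level of `g − 1`**: for `k, k⁻¹` integral, «entries of `k g k⁻¹ − 1` are `≤ c`» iff «entries of `g − 1` are `≤ c`».
[cite: Tits1979, §3.5] -/
theorem forall_v_conj_sub_one_apply_le_iff {N : ℕ} {k : GL (Fin N) K} (hk : IsIntMatrix (k : Matrix (Fin N) (Fin N) K))
    (hki : IsIntMatrix ((k⁻¹ : GL (Fin N) K) : Matrix (Fin N) (Fin N) K)) (g : GL (Fin N) K) (c : ℤᵐ⁰) :
    (∀ a b, Valued.v ((((k * g * k⁻¹ : GL (Fin N) K) : Matrix (Fin N) (Fin N) K) - 1) a b) ≤ c) ↔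
      ∀ a b, Valued.v ((((g : GL (Fin N) K) : Matrix (Fin N) (Fin N) K) - 1) a b) ≤ c := by
  constructor
  · intro h
    have h' := forall_v_mul_mul_apply_le hki hk h
    rw [coe_conj_sub_one, ← Matrix.mul_assoc, ← Matrix.mul_assoc, ← Units.val_mul, inv_mul_cancel, Units.val_one, Matrix.one_mul,
      Matrix.mul_assoc, ← Units.val_mul, inv_mul_cancel, Units.val_one, Matrix.mul_one] at h'
    exact h'
  · intro h
    rw [coe_conj_sub_one]
    exact forall_v_mul_mul_apply_le hk hki h

/-- **`GL_N(𝒪)`-conjugation preserves the level of `(g − 1)²`.** [cite: Tits1979, §3.5] -/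
theorem forall_v_conj_sub_one_sq_apply_le_iff {N : ℕ} {k : GL (Fin N) K} (hk : IsIntMatrix (k : Matrix (Fin N) (Fin N) K))
    (hki : IsIntMatrix ((k⁻¹ : GL (Fin N) K) : Matrix (Fin N) (Fin N) K)) (g : GL (Fin N) K) (c : ℤᵐ⁰) :
    (∀ a b, Valued.v (((((k * g * k⁻¹ : GL (Fin N) K) : Matrix (Fin N) (Fin N) K) - 1) *
        ((((k * g * k⁻¹ : GL (Fin N) K) : Matrix (Fin N) (Fin N) K) - 1))) a b) ≤ c) ↔
      ∀ a b, Valued.v (((((g : GL (Fin N) K) : Matrix (Fin N) (Fin N) K) - 1) * (((g : GL (Fin N) K) : Matrix (Fin N) (Fin N) K) - 1)) a b) ≤ c := by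
  rw [coe_conj_sub_one_sq_eq]
  constructor
  · intro h
    have h' := forall_v_mul_mul_apply_le hki hk h
    rw [← Matrix.mul_assoc, ← Matrix.mul_assoc, ← Units.val_mul, inv_mul_cancel, Units.val_one, Matrix.one_mul,
      Matrix.mul_assoc, ← Units.val_mul, inv_mul_cancel, Units.val_one, Matrix.mul_one] at h'
    exact h'
  · intro h
    exact forall_v_mul_mul_apply_le hk hki h

/-- **`GL_N(𝒪)`-conjugation preserves integrality.** [cite: Tits1979, §3.5] -/
theorem isIntMatrix_conj_iff {N : ℕ} {k : GL (Fin N) K} (hk : IsIntMatrix (k : Matrix (Fin N) (Fin N) K))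
    (hki : IsIntMatrix ((k⁻¹ : GL (Fin N) K) : Matrix (Fin N) (Fin N) K)) (g : GL (Fin N) K) :
    IsIntMatrix ((k * g * k⁻¹ : GL (Fin N) K) : Matrix (Fin N) (Fin N) K) ↔ IsIntMatrix ((g : GL (Fin N) K) : Matrix (Fin N) (Fin N) K) := by
  constructor
  · intro h
    have h' := isIntMatrix_mul (isIntMatrix_mul hki h) hk
    rw [Units.val_mul, Units.val_mul, ← Matrix.mul_assoc, ← Matrix.mul_assoc, ← Units.val_mul, inv_mul_cancel, Units.val_one, Matrix.one_mul,
      Matrix.mul_assoc, ← Units.val_mul, inv_mul_cancel, Units.val_one, Matrix.mul_one] at h'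
    exact h'
  · intro h
    rw [Units.val_mul, Units.val_mul]
    exact isIntMatrix_mul (isIntMatrix_mul hk h) hki

/-- **Left multiplication by a deep element preserves the level of `g − 1`**: if `u − 1` has entries `≤ c′ ≤ c` and `g` is integral, then «entries of `u g − 1` are
`≤ c`» iff «entries of `g − 1` are `≤ c`» (`u g − 1 = (u − 1) g + (g − 1)`). [cite: Tits1979, §3.5] -/
theorem forall_v_mul_sub_one_apply_le_iff {N : ℕ} {u g : GL (Fin N) K} {c c' : ℤᵐ⁰} (hu : ∀ a b, Valued.v ((((u : GL (Fin N) K) : Matrix (Fin N) (Fin N) K) - 1) a b) ≤ c')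
    (hg : IsIntMatrix ((g : GL (Fin N) K) : Matrix (Fin N) (Fin N) K)) (hc : c' ≤ c) :
    (∀ a b, Valued.v ((((u * g : GL (Fin N) K) : Matrix (Fin N) (Fin N) K) - 1) a b) ≤ c) ↔
      ∀ a b, Valued.v ((((g : GL (Fin N) K) : Matrix (Fin N) (Fin N) K) - 1) a b) ≤ c := by
  refine forall_v_apply_le_iff_of_sub fun a b => ?_
  have hE : (((u * g : GL (Fin N) K) : Matrix (Fin N) (Fin N) K) - 1) - (((g : GL (Fin N) K) : Matrix (Fin N) (Fin N) K) - 1) =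
      (((u : GL (Fin N) K) : Matrix (Fin N) (Fin N) K) - 1) * ((g : GL (Fin N) K) : Matrix (Fin N) (Fin N) K) := by
    rw [Units.val_mul, Matrix.sub_mul, Matrix.one_mul]; abel
  rw [hE, Matrix.mul_apply]
  refine Valuation.map_sum_le _ fun l _ => ?_
  exact (v_mul_le_of_le_of_le_one (hu a l) (hg l b)).trans hc



/-- **Left multiplication by a deep element preserves the level of `(g − 1)²`**: if `u − 1` has entries `≤ c′` with `c′ ≤ c`, `c′ ≤ 1`, and `g` is integral, then
«entries of `(u g − 1)²` are `≤ c`» iff «entries of `(g − 1)²` are `≤ c`» (`(u g − 1)² − (g − 1)² = (g−1)E + E(g−1) + E²`, `E = (u−1)g`). [cite: Tits1979, §3.5] -/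
theorem forall_v_mul_sub_one_sq_apply_le_iff {N : ℕ} {u g : GL (Fin N) K} {c c' : ℤᵐ⁰}
    (hu : ∀ a b, Valued.v ((((u : GL (Fin N) K) : Matrix (Fin N) (Fin N) K) - 1) a b) ≤ c')
    (hg : IsIntMatrix ((g : GL (Fin N) K) : Matrix (Fin N) (Fin N) K)) (hc : c' ≤ c) (hc1 : c' ≤ 1) :
    (∀ a b, Valued.v (((((u * g : GL (Fin N) K) : Matrix (Fin N) (Fin N) K) - 1) * (((u * g : GL (Fin N) K) : Matrix (Fin N) (Fin N) K) - 1)) a b) ≤ c) ↔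
      ∀ a b, Valued.v (((((g : GL (Fin N) K) : Matrix (Fin N) (Fin N) K) - 1) * (((g : GL (Fin N) K) : Matrix (Fin N) (Fin N) K) - 1)) a b) ≤ c := by
  set E : Matrix (Fin N) (Fin N) K := (((u : GL (Fin N) K) : Matrix (Fin N) (Fin N) K) - 1) * ((g : GL (Fin N) K) : Matrix (Fin N) (Fin N) K) with hEdef
  set D : Matrix (Fin N) (Fin N) K := ((g : GL (Fin N) K) : Matrix (Fin N) (Fin N) K) - 1 with hDdef
  have hE : ∀ a b, Valued.v (E a b) ≤ c' := fun a b => by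
    rw [hEdef, Matrix.mul_apply]
    exact Valuation.map_sum_le _ fun l _ => v_mul_le_of_le_of_le_one (hu a l) (hg l b)
  have hEint : IsIntMatrix E := fun a b => (hE a b).trans hc1
  have hD : IsIntMatrix D := isIntMatrix_sub hg isIntMatrix_one
  have hX : ((u * g : GL (Fin N) K) : Matrix (Fin N) (Fin N) K) - 1 = D + E := by
    rw [hDdef, hEdef, Units.val_mul, Matrix.sub_mul, Matrix.one_mul]; abel
  refine forall_v_apply_le_iff_of_sub fun a b => ?_
  have hdiff : (D + E) * (D + E) - D * D = D * E * 1 + 1 * E * (D + E) := by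
    rw [Matrix.mul_one, Matrix.one_mul, Matrix.add_mul, Matrix.mul_add]; abel
  rw [hX, hdiff, Matrix.add_apply]
  refine v_add_le_of_le ?_ ?_
  · exact (forall_v_mul_mul_apply_le hD isIntMatrix_one hE a b).trans hc
  · exact (forall_v_mul_mul_apply_le isIntMatrix_one (isIntMatrix_add hD hEint) hE a b).trans hc

end Literature.NumberTheory.Automorphic.UnitaryLatticeTree
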